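import Summits.ValiantsHypothesis.ValiantsHypothesis.Theorems.KPlusLogSqLawTropicalGradedWalkDomDGlue2
import Summits.ValiantsHypothesis.ValiantsHypothesis.Theorems.KPlusLogSqLawTropicalGradedWalkDomDGlue3
import Summits.ValiantsHypothesis.ValiantsHypothesis.Theorems.KPlusLogSqLawTropicalGradedWalkDomDGlue4

/-!
# Dominance of the diagonal states (type D)

GRW-lite `K = 4` graded-walk family (census side of the tropical root law, all `m`):
dominance glue for the diagonal states `(w, u, 0)`, `u < w < m`, of the design typed in
`KPlusLogSqLawTropicalGradedWalkDefs`.  The slack of every rival cell against the column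
potential `UD` (file `…PotD`) was certified family by family in `…DomD1` – `…DomD13`; the files
`…DomDGlue1` – `…DomDGlue5` dispatch an arbitrary rival `(a, b, l)` to its family and conclude
`IsDominant` for these states via `isDominant_of_scaledPotential`.

Honest framing: this is a census-side (lower-bound) construction — a quadratic family of
distinct optimal slopes for `TropRootLawAt (n+1) 4`.  It says nothing about `TropicalB` inside
its window and nothing about VP ≠ VNP.

Main result of this part: `isDominant_D` — every state `(w, u, 0)` with `u < w ≤ n` is the unique optimal
assignment at its slope `theta n w u 0` for the weights `vv n`, degrees `dd n`.
-/

set_option linter.dupNamespace false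
set_option autoImplicit false

namespace Summit.ValiantsHypothesis.ValiantsHypothesis.Theorems.LacunarySymmetroidMatrixDescartes.TropicalCensus

namespace GradedWalk

open Summit.ValiantsHypothesis.ValiantsHypothesis.Theorems.MatrixDescartes.Negative

variable (n : ℕ)

/-! ### the dominance theorem for the diagonal states of the phases `w < m` -/

/-- **The diagonal state `(w, u, 0)`, `u < w < m`, of the GRW-lite design is the unique optimum at its slope.** -/
theorem isDominant_D (w u : ℕ) (huw : u < w) (hwn : w ≤ n) :
    IsDominant (dd n) (vv n) (ee n) (theta n w u 0) (cterm n w u 0) := by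
  have hw1 : w ≤ n + 1 := by omega
  rw [theta_D n huw (by omega)]
  unfold cterm
  rw [perm_D n (Nat.ne_of_lt huw)]
  refine isDominant_of_scaledPotential (dd n) (vv n) (ee n) (thD n w u) (rot n w) (lam n w u 0) 1 one_pos
    (fun a => UD n w u a)
    (fun b => (thD n w u * (dd n (lam n w u 0 b) : ℤ) - vv n (rot n w b) b (lam n w u 0 b)) - UD n w u (rot n w b)) ?_ ?_ ?_
  · -- presence of the intended incidences
    intro i
    rw [lam_D n huw]
    by_cases hi : (i : ℕ) < w
    · have hr := rot_val_blk n hw1 i hi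
      rw [if_neg (by omega)]
      have hlow : (i : ℕ) < ((rot n w i : Fin (n + 1)) : ℕ) := by rw [hr]; omega
      split_ifs
      · exact ee_lower_ne n hlow 2 (by decide)
      · exact ee_lower_ne n hlow 1 (by decide)
    · have hr := rot_val_wrap n hw1 i (by omega)
      rw [if_pos (by omega)]
      have hup : ((rot n w i : Fin (n + 1)) : ℕ) < (i : ℕ) := by rw [hr]; omega
      exact ee_upper_zero_ne n hup
  · -- tightness (by definition of the column potential)
    intro i; ring
  · -- slack
    intro a b l hp hne
    by_cases hwb : w ≤ (b : ℕ)
    · exact slackD_wrapcol n w u huw hwn a b l hp hne hwb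
    · have hbw : (b : ℕ) < w := Nat.lt_of_not_le hwb
      rcases Nat.lt_or_ge (a : ℕ) (b : ℕ) with hab | hab
      · rcases (show l = 0 ∨ l = 1 ∨ l = 2 ∨ l = 3 by fin_cases l <;> simp) with rfl | rfl | rfl | rfl
        · exact slackD_blk_wrap0 n w u huw hwn a b hbw hab
        · exact slackD_blk_wrap1 n w u huw hwn a b hbw hab
        · exact absurd (ee_upper_ge_two n hab 2 (by decide)) hp
        · exact absurd (ee_upper_ge_two n hab 3 (by decide)) hp
      · rcases Nat.lt_or_ge (a : ℕ) ((b : ℕ) + (n + 1 - w)) with halt | hge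
        · exact slackD_blk_up n w u huw hwn a b l hp hbw hab halt
        · exact slackD_blk_ge n w u huw hwn a b l hp hne hbw hge

end GradedWalk

end Summit.ValiantsHypothesis.ValiantsHypothesis.Theorems.LacunarySymmetroidMatrixDescartes.TropicalCensus
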